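import Literature.MathematicalPhysics.QuantumLattice.ApproximateEigenvectorLemmas
import Literature.MathematicalPhysics.QuantumLattice.LiebRobinsonIntegralProofs
import Mathlib.Analysis.Calculus.Deriv.MeanValue
import HarnessLib

/-!
# Variational stationarity: a vector of almost minimal energy in a sector is almost stationary

Topic `Literature/MathematicalPhysics/QuantumLattice`; finite-dimensional (matrix) form of the
passivity / minimal-energy ⇒ invariance principle of Pusz–Woronowicz (1978) and
Bratteli–Kishimoto–Robinson (1978): a translation-invariant state of minimal mean energy is a ground
state, in particular invariant under the dynamics. Everything is PROVED; no definition, no named fact,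
no `sorry`.

QUANTITATIVE FINITE-VOLUME VERSION (`abs_im_expect_commutator_le_sqrt`). Let `H`, `B` be Hermitian
matrices, `Q` a matrix commuting with `B` ("sector charge"), `φ` a unit vector with `Q φ = q φ`, and
suppose `E ≤ Re⟨χ, H χ⟩` for every unit `χ` with `Q χ = q χ` (sector floor) while
`Re⟨φ, H φ⟩ ≤ E + ε` (excess `ε`). If `|Re⟨χ, [B,[B,H]] χ⟩| ≤ D` for all unit `χ`, then
`|Im⟨φ, (HB − BH) φ⟩| ≤ √(2 ε D)`.
Proof: the rotated vectors `χ_t = e^{-itB} φ` stay in the sector and are unit, so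
`k(t) = Re⟨χ_t, H χ_t⟩ = Re⟨φ, τ^B_t(H) φ⟩ ≥ E ≥ k(0) − ε` for all real `t`; `k'(0) = Im⟨φ,(HB−BH)φ⟩`
(`hasDerivAt_heisenbergEvolution`) and `|k''| ≤ D`; a function with `k'' ≤ D` obeys
`k(t) ≤ k(0) + t k'(0) + D t²/2` (`le_taylor_two_of_deriv2_le`), and `t = −k'(0)/D` gives
`k'(0)² ≤ 2 ε D` (`sq_le_two_mul_of_quadratic_lower_bound`).

USE (crew hubbard-obs, one-point / Koma–Tasaki tower route to pair-LRO ceilings): each charge-sector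
component of the tower witness has total energy `O(1)` above the minimum of its own particle-number
sector, while for `B` the translation SUM of a local word `[B,[B,H_L]] = O(L²)` (locality); hence the
translation-averaged stationarity defect `|⟨[H_L, B]⟩|/L² = O(1/L)`: the equation-of-motion rows of the
reduced-density-matrix bootstrap are sound for that witness WITHOUT any chemical-potential / sector
convexity licence.

References: W. Pusz, S. L. Woronowicz, Comm. Math. Phys. 58 (1978) 273, §1 (passive states are
invariant) [PuszWoronowicz1978]; O. Bratteli, D. W. Robinson, *Operator Algebras and Quantum
Statistical Mechanics 2* (1997), §5.3.3 (passivity) and §6.2.4 (ground states of lattice systems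
minimise the mean energy) [BratteliRobinsonII1997].
-/

noncomputable section

namespace Literature.MathematicalPhysics.QuantumLattice

open Matrix Complex NormedSpace Set
open scoped Matrix.Norms.L2Operator ComplexOrder

/-! ### §1  One-variable calculus: second-order Taylor upper bound and the quadratic optimisation -/

section Calculus

/-- **Second-order Taylor upper bound.** If `k : ℝ → ℝ` is twice differentiable with `k'' ≤ D`
everywhere, then `k t ≤ k 0 + t·k' 0 + D t²/2` for every real `t` (the function
`k 0 + t k' 0 + D t²/2 − k t` has vanishing value and derivative at `0` and nonnegative second
derivative, hence is monotone on `[0, ∞)` and antitone on `(−∞, 0]`). [folklore] -/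
private theorem le_taylor_two_of_deriv2_le {k k' k'' : ℝ → ℝ} {D : ℝ}
    (hk : ∀ t, HasDerivAt k (k' t) t) (hk' : ∀ t, HasDerivAt k' (k'' t) t) (hD : ∀ t, k'' t ≤ D)
    (t : ℝ) : k t ≤ k 0 + t * k' 0 + D * t ^ 2 / 2 := by
  -- `h t = k 0 + t k' 0 + D t²/2 − k t`, `h' t = k' 0 + D t − k' t`, `h'' t = D − k'' t ≥ 0`
  set h : ℝ → ℝ := fun s => k 0 + s * k' 0 + D * s ^ 2 / 2 - k s with hh
  set h' : ℝ → ℝ := fun s => k' 0 + D * s - k' s with hh'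
  have hder : ∀ s, HasDerivAt h (h' s) s := by
    intro s
    have h1 : HasDerivAt (fun s : ℝ => k 0 + s * k' 0 + D * s ^ 2 / 2) (k' 0 + D * s) s := by
      have ha : HasDerivAt (fun s : ℝ => s * k' 0) (1 * k' 0) s := (hasDerivAt_id s).mul_const _
      have hb : HasDerivAt (fun s : ℝ => D * s ^ 2 / 2) (D * ((2 : ℕ) * s ^ (2 - 1) * 1) / 2) s :=
        (((hasDerivAt_id s).pow 2).const_mul D).div_const 2
      have hab := (ha.const_add (k 0)).add hb
      refine hab.congr_deriv ?_
      simp only [one_mul, Nat.cast_ofNat, mul_one]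
      ring
    exact h1.sub (hk s)
  have hder' : ∀ s, HasDerivAt h' (D - k'' s) s := by
    intro s
    have h1 : HasDerivAt (fun s : ℝ => k' 0 + D * s) (D * 1) s :=
      ((hasDerivAt_id s).const_mul D).const_add _
    have h2 : HasDerivAt h' (D * 1 - k'' s) s := h1.sub (hk' s)
    simpa using h2
  -- `h'` is monotone, `h' 0 = 0`
  have hmono' : Monotone h' := by
    refine monotone_of_deriv_nonneg (fun s => (hder' s).differentiableAt) fun s => ?_
    rw [(hder' s).deriv]
    linarith [hD s]
  have h'0 : h' 0 = 0 := by simp [hh']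
  have h0 : h 0 = 0 := by simp [hh]
  have hcont : Continuous h := continuous_iff_continuousAt.2 fun s => (hder s).continuousAt
  -- `h ≥ 0` on `[0, ∞)` and on `(−∞, 0]`
  have hnonneg : 0 ≤ h t := by
    rcases le_total 0 t with ht | ht
    · have hmono : MonotoneOn h (Ici 0) := by
        refine monotoneOn_of_deriv_nonneg (convex_Ici 0) hcont.continuousOn
          (fun s _ => (hder s).differentiableAt.differentiableWithinAt) fun s hs => ?_
        rw [(hder s).deriv, ← h'0]
        rw [interior_Ici] at hs
        exact hmono' (le_of_lt hs)
      have := hmono (self_mem_Ici) (mem_Ici.2 ht) ht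
      rwa [h0] at this
    · have hanti : AntitoneOn h (Iic 0) := by
        refine antitoneOn_of_deriv_nonpos (convex_Iic 0) hcont.continuousOn
          (fun s _ => (hder s).differentiableAt.differentiableWithinAt) fun s hs => ?_
        rw [(hder s).deriv, ← h'0]
        rw [interior_Iic] at hs
        exact hmono' (le_of_lt hs)
      have := hanti (mem_Iic.2 ht) (self_mem_Iic) ht
      rwa [h0] at this
  simp only [hh] at hnonneg
  linarith

/-- **The quadratic optimisation.** If `−ε ≤ t·a + D t²/2` for every real `t`, with `0 ≤ D`, then
`a² ≤ 2 ε D` (take `t = −a/D`; for `D = 0` the linear function `t ↦ t a` is bounded below only if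
`a = 0`). [folklore] -/
private theorem sq_le_two_mul_of_quadratic_lower_bound {a D ε : ℝ} (hD : 0 ≤ D)
    (h : ∀ t : ℝ, -ε ≤ t * a + D * t ^ 2 / 2) : a ^ 2 ≤ 2 * ε * D := by
  rcases hD.lt_or_eq with hDpos | hD0
  · have ht := h (-a / D)
    have e : -a / D * a + D * (-a / D) ^ 2 / 2 = -(a ^ 2 / (2 * D)) := by
      field_simp
      ring
    rw [e] at ht
    have h2 : a ^ 2 / (2 * D) ≤ ε := by linarith
    have h3 := (div_le_iff₀ (by positivity)).1 h2
    calc a ^ 2 ≤ ε * (2 * D) := h3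
      _ = 2 * ε * D := by ring
  · -- `D = 0`: `t a ≥ −ε` for all `t` forces `a = 0`
    subst hD0
    have ha : a = 0 := by
      by_contra hne
      have ht := h (-(ε + 1) / a)
      have e : -(ε + 1) / a * a + 0 * (-(ε + 1) / a) ^ 2 / 2 = -(ε + 1) := by
        rw [zero_mul, zero_div, add_zero, div_mul_cancel₀ _ hne]
      rw [e] at ht
      linarith
    subst ha
    simp

/-- **Almost minimal ⇒ almost stationary (scalar form).** A twice differentiable `k : ℝ → ℝ` with
`k'' ≤ D` (`D ≥ 0`) which nowhere drops more than `ε` below its value at `0` (`k 0 − ε ≤ k t` for all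
`t`) has `|k' 0| ≤ √(2 ε D)`. [cite: PuszWoronowicz1978, §1] -/
theorem abs_deriv_le_sqrt_of_forall_ge {k k' k'' : ℝ → ℝ} {D ε : ℝ} (hD : 0 ≤ D)
    (hk : ∀ t, HasDerivAt k (k' t) t) (hk' : ∀ t, HasDerivAt k' (k'' t) t) (hD' : ∀ t, k'' t ≤ D)
    (hmin : ∀ t, k 0 - ε ≤ k t) : |k' 0| ≤ Real.sqrt (2 * ε * D) := by
  have hq : ∀ t : ℝ, -ε ≤ t * k' 0 + D * t ^ 2 / 2 := by
    intro t
    have h1 := le_taylor_two_of_deriv2_le hk hk' hD' t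
    linarith [hmin t]
  have hsq := sq_le_two_mul_of_quadratic_lower_bound hD hq
  rw [← Real.sqrt_sq_eq_abs]
  exact Real.sqrt_le_sqrt hsq

end Calculus

/-! ### §2  Rotated vectors `e^{-itB} φ`: unit, in the sector, and the energy function -/

section Matrix

variable {n : Type*} [Fintype n] [DecidableEq n]

/-- For Hermitian `B`, `(e^{(−it)B})ᴴ = e^{(it)B}` (companion of `conjTranspose_exp_I_mul_smul`).
[folklore] -/
private theorem conjTranspose_exp_neg_I_mul_smul {B : Matrix n n ℂ} (hB : B.IsHermitian) (t : ℝ) :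
    (NormedSpace.exp ((-(I * (t : ℂ))) • B))ᴴ = NormedSpace.exp ((I * (t : ℂ)) • B) := by
  rw [← Matrix.exp_conjTranspose, conjTranspose_smul, hB.eq]
  congr 2
  simp

/-- The rotated vector `e^{cB} φ` of a unit vector is a unit vector (`c̄ = −c`, `B` Hermitian).
[folklore] -/
private theorem star_dotProduct_exp_smul_mulVec_self {B : Matrix n n ℂ} (hB : B.IsHermitian) {c : ℂ}
    (hc : star c = -c) {φ : n → ℂ} (hφ : star φ ⬝ᵥ φ = 1) :
    star (NormedSpace.exp (c • B) *ᵥ φ) ⬝ᵥ (NormedSpace.exp (c • B) *ᵥ φ) = 1 := by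
  have hU := Unitary.star_mul_self_of_mem (exp_smul_mem_unitary hB hc)
  rw [star_eq_conjTranspose] at hU
  rw [star_mulVec, ← dotProduct_mulVec, mulVec_mulVec, hU, one_mulVec, hφ]

/-- The rotation `e^{cB}` preserves the eigenspaces of every `Q` commuting with `B`. [folklore] -/
private theorem mulVec_exp_smul_mulVec_of_commute {B Q : Matrix n n ℂ} (hBQ : Commute B Q) (c : ℂ)
    {q : ℂ} {φ : n → ℂ} (hφ : Q *ᵥ φ = q • φ) :
    Q *ᵥ (NormedSpace.exp (c • B) *ᵥ φ) = q • (NormedSpace.exp (c • B) *ᵥ φ) := by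
  have hc : Commute Q (NormedSpace.exp (c • B)) := (hBQ.symm.smul_right c).exp_right
  rw [mulVec_mulVec, hc.eq, ← mulVec_mulVec, hφ, mulVec_smul]

/-- The expectation of a Heisenberg-evolved observable is the expectation in the rotated vector:
`⟨φ, τ^B_t(M) φ⟩ = ⟨χ_t, M χ_t⟩`, `χ_t = e^{−itB} φ` (`B` Hermitian). [cite: BratteliRobinsonII1997, §6.2.4] -/
theorem dotProduct_heisenbergEvolution_mulVec {B : Matrix n n ℂ} (hB : B.IsHermitian) (t : ℝ)
    (M : Matrix n n ℂ) (φ : n → ℂ) :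
    star φ ⬝ᵥ (heisenbergEvolution B t M *ᵥ φ) =
      star (NormedSpace.exp ((-(I * (t : ℂ))) • B) *ᵥ φ) ⬝ᵥ
        (M *ᵥ (NormedSpace.exp ((-(I * (t : ℂ))) • B) *ᵥ φ)) := by
  rw [heisenbergEvolution, ← mulVec_mulVec, ← mulVec_mulVec, dotProduct_mulVec, star_mulVec,
    conjTranspose_exp_neg_I_mul_smul hB]

/-- The energy function `t ↦ Re⟨φ, τ^B_t(M) φ⟩` is differentiable with derivative
`Re⟨φ, τ^B_t((iB)M − M(iB)) φ⟩` (`hasDerivAt_heisenbergEvolution`). [cite: BratteliRobinsonII1997, §6.2.4] -/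
theorem hasDerivAt_re_dotProduct_heisenbergEvolution (B M : Matrix n n ℂ) (φ : n → ℂ) (t : ℝ) :
    HasDerivAt (fun u : ℝ => (star φ ⬝ᵥ (heisenbergEvolution B u M *ᵥ φ)).re)
      ((star φ ⬝ᵥ (heisenbergEvolution B t ((I • B) * M - M * (I • B)) *ᵥ φ)).re) t := by
  -- the linear functional `X ↦ ⟨φ, X φ⟩`
  set L : Matrix n n ℂ →ₗ[ℂ] ℂ :=
    { toFun := fun X => star φ ⬝ᵥ (X *ᵥ φ)
      map_add' := fun X Y => by rw [add_mulVec, dotProduct_add]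
      map_smul' := fun c X => by rw [smul_mulVec, dotProduct_smul, RingHom.id_apply] } with hL
  set Lc : Matrix n n ℂ →L[ℂ] ℂ := LinearMap.toContinuousLinearMap L with hLc
  have hderiv := hasDerivAt_heisenbergEvolution B M t
  have h1 := ((Lc.restrictScalars ℝ).hasFDerivAt.comp_hasDerivAt t hderiv)
  have h2 := (Complex.reCLM.hasFDerivAt.comp_hasDerivAt t h1)
  have e : heisenbergEvolution B t ((I • B) * M - M * (I • B)) =
      NormedSpace.exp (t • (I • B)) * ((I • B) * M - M * (I • B)) * NormedSpace.exp (t • (-(I • B))) :=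
    heisenbergEvolution_eq_exp_smul B t _
  rw [e]
  refine h2.congr_deriv ?_
  simp [hLc, hL]

/-! ### §3  The theorem -/

/-- **Variational stationarity (finite-volume Pusz–Woronowicz / Bratteli–Kishimoto–Robinson).**
`B` Hermitian, `H` any matrix, `Q` commuting with `B`, `φ` a unit vector with `Qφ = qφ`; `E` a lower bound of
`Re⟨χ, Hχ⟩` over the unit vectors of the `q`-eigenspace of `Q` and `Re⟨φ, Hφ⟩ ≤ E + ε`; `D ≥ 0` a bound
of `|Re⟨χ, [B,[B,H]] χ⟩|` over unit `χ`. Then `|Im⟨φ, (HB − BH) φ⟩| ≤ √(2 ε D)`: a vector of almost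
minimal energy within its sector is almost stationary against every sector-preserving one-parameter
rotation, quantitatively. [cite: PuszWoronowicz1978, §1] [cite: BratteliRobinsonII1997, §5.3.3 and §6.2.4] -/
theorem abs_im_expect_commutator_le_sqrt {H B Q : Matrix n n ℂ}
    (hB : B.IsHermitian) (hBQ : Commute B Q) {q : ℂ} {φ : n → ℂ} (hφ1 : star φ ⬝ᵥ φ = 1)
    (hφQ : Q *ᵥ φ = q • φ) {E ε D : ℝ} (hD : 0 ≤ D)
    (hfloor : ∀ χ : n → ℂ, star χ ⬝ᵥ χ = 1 → Q *ᵥ χ = q • χ → E ≤ (star χ ⬝ᵥ (H *ᵥ χ)).re)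
    (hε : (star φ ⬝ᵥ (H *ᵥ φ)).re ≤ E + ε)
    (hDD : ∀ χ : n → ℂ, star χ ⬝ᵥ χ = 1 →
      |(star χ ⬝ᵥ ((B * (B * H - H * B) - (B * H - H * B) * B) *ᵥ χ)).re| ≤ D) :
    |(star φ ⬝ᵥ ((H * B - B * H) *ᵥ φ)).im| ≤ Real.sqrt (2 * ε * D) := by
  -- the energy along the rotation and its first two derivatives
  set C₁ : Matrix n n ℂ := (I • B) * H - H * (I • B) with hC₁
  set C₂ : Matrix n n ℂ := (I • B) * C₁ - C₁ * (I • B) with hC₂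
  set k : ℝ → ℝ := fun u => (star φ ⬝ᵥ (heisenbergEvolution B u H *ᵥ φ)).re with hk
  set k' : ℝ → ℝ := fun u => (star φ ⬝ᵥ (heisenbergEvolution B u C₁ *ᵥ φ)).re with hk'
  set k'' : ℝ → ℝ := fun u => (star φ ⬝ᵥ (heisenbergEvolution B u C₂ *ᵥ φ)).re with hk''
  have hk1 : ∀ u, HasDerivAt k (k' u) u := fun u => hasDerivAt_re_dotProduct_heisenbergEvolution B H φ u
  have hk2 : ∀ u, HasDerivAt k' (k'' u) u := fun u =>
    hasDerivAt_re_dotProduct_heisenbergEvolution B C₁ φ u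
  -- the rotated vectors are unit vectors of the sector
  have hI : ∀ u : ℝ, star (-(I * (u : ℂ))) = -(-(I * (u : ℂ))) := fun u => by simp
  have hunit : ∀ u : ℝ, star (NormedSpace.exp ((-(I * (u : ℂ))) • B) *ᵥ φ) ⬝ᵥ
      (NormedSpace.exp ((-(I * (u : ℂ))) • B) *ᵥ φ) = 1 := fun u =>
    star_dotProduct_exp_smul_mulVec_self hB (hI u) hφ1
  have hsect : ∀ u : ℝ, Q *ᵥ (NormedSpace.exp ((-(I * (u : ℂ))) • B) *ᵥ φ) =
      q • (NormedSpace.exp ((-(I * (u : ℂ))) • B) *ᵥ φ) := fun u =>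
    mulVec_exp_smul_mulVec_of_commute hBQ _ hφQ
  -- `C₂ = -[B,[B,H]]`, so `|k''| ≤ D`
  have hC₂eq : C₂ = -(B * (B * H - H * B) - (B * H - H * B) * B) := by
    simp only [hC₂, hC₁, Matrix.smul_mul, Matrix.mul_smul, smul_sub, smul_smul, I_mul_I, Matrix.mul_sub,
      Matrix.sub_mul]
    simp only [neg_smul, one_smul]
    abel
  have hD' : ∀ u, k'' u ≤ D := by
    intro u
    simp only [hk'']
    rw [dotProduct_heisenbergEvolution_mulVec hB, hC₂eq, neg_mulVec, dotProduct_neg, Complex.neg_re]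
    have h := hDD _ (hunit u)
    exact (neg_le_abs _).trans h
  -- `k 0 − ε ≤ E ≤ k u`
  have hk0 : k 0 = (star φ ⬝ᵥ (H *ᵥ φ)).re := by simp [hk]
  have hmin : ∀ u, k 0 - ε ≤ k u := by
    intro u
    have hE : E ≤ k u := by
      simp only [hk]
      rw [dotProduct_heisenbergEvolution_mulVec hB]
      exact hfloor _ (hunit u) (hsect u)
    linarith
  have hmain := abs_deriv_le_sqrt_of_forall_ge hD hk1 hk2 hD' hmin
  -- `k' 0 = Im⟨φ, (HB − BH) φ⟩`
  have hk'0 : k' 0 = (star φ ⬝ᵥ ((H * B - B * H) *ᵥ φ)).im := by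
    simp only [hk', heisenbergEvolution_zero, hC₁]
    have e : (I • B) * H - H * (I • B) = (-I) • (H * B - B * H) := by
      rw [Matrix.smul_mul, Matrix.mul_smul, smul_sub, neg_smul, neg_smul]
      abel
    rw [e, smul_mulVec, dotProduct_smul, smul_eq_mul]
    simp [Complex.mul_re]
  rw [← hk'0]
  exact hmain

omit [DecidableEq n] in
/-- For Hermitian `H`, `B` the expectation `⟨φ, (HB − BH) φ⟩` is purely imaginary. [folklore] -/
private theorem re_expect_commutator_eq_zero {H B : Matrix n n ℂ} (hH : H.IsHermitian) (hB : B.IsHermitian)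
    (φ : n → ℂ) : (star φ ⬝ᵥ ((H * B - B * H) *ᵥ φ)).re = 0 := by
  have hskew : (H * B - B * H)ᴴ = -(H * B - B * H) := by
    rw [conjTranspose_sub, conjTranspose_mul, conjTranspose_mul, hH.eq, hB.eq, neg_sub]
  have h1 : star (star φ ⬝ᵥ ((H * B - B * H) *ᵥ φ)) = star ((H * B - B * H) *ᵥ φ) ⬝ᵥ φ := by
    rw [star_dotProduct, star_star]
  have h2 : star ((H * B - B * H) *ᵥ φ) ⬝ᵥ φ = -(star φ ⬝ᵥ ((H * B - B * H) *ᵥ φ)) := by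
    rw [star_mulVec, hskew, Matrix.vecMul_neg, neg_dotProduct, ← dotProduct_mulVec]
  have h : star (star φ ⬝ᵥ ((H * B - B * H) *ᵥ φ)) = -(star φ ⬝ᵥ ((H * B - B * H) *ᵥ φ)) :=
    h1.trans h2
  have h2 := congrArg Complex.re h
  rw [Complex.star_def, Complex.conj_re, Complex.neg_re] at h2
  linarith

/-- **Norm form.** Under the hypotheses of `abs_im_expect_commutator_le_sqrt`:
`‖⟨φ, (HB − BH) φ⟩‖ ≤ √(2 ε D)` (the real part vanishes). [cite: PuszWoronowicz1978, §1] -/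
theorem norm_expect_commutator_le_sqrt {H B Q : Matrix n n ℂ} (hH : H.IsHermitian)
    (hB : B.IsHermitian) (hBQ : Commute B Q) {q : ℂ} {φ : n → ℂ} (hφ1 : star φ ⬝ᵥ φ = 1)
    (hφQ : Q *ᵥ φ = q • φ) {E ε D : ℝ} (hD : 0 ≤ D)
    (hfloor : ∀ χ : n → ℂ, star χ ⬝ᵥ χ = 1 → Q *ᵥ χ = q • χ → E ≤ (star χ ⬝ᵥ (H *ᵥ χ)).re)
    (hε : (star φ ⬝ᵥ (H *ᵥ φ)).re ≤ E + ε)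
    (hDD : ∀ χ : n → ℂ, star χ ⬝ᵥ χ = 1 →
      |(star χ ⬝ᵥ ((B * (B * H - H * B) - (B * H - H * B) * B) *ᵥ χ)).re| ≤ D) :
    ‖star φ ⬝ᵥ ((H * B - B * H) *ᵥ φ)‖ ≤ Real.sqrt (2 * ε * D) := by
  have him := abs_im_expect_commutator_le_sqrt hB hBQ hφ1 hφQ hD hfloor hε hDD
  have hre := re_expect_commutator_eq_zero hH hB φ
  set z := star φ ⬝ᵥ ((H * B - B * H) *ᵥ φ) with hz
  have e : z = ((z.im : ℝ) : ℂ) * I := by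
    apply Complex.ext <;> simp [hre]
  rw [e, norm_mul, Complex.norm_I, mul_one, Complex.norm_real, Real.norm_eq_abs]
  exact him

/-- **Non-Hermitian words.** For `X = B₁ + i B₂` with `B₁`, `B₂` Hermitian and commuting with the
sector charge `Q` (e.g. the Hermitian and anti-Hermitian parts of a number-conserving word), under the
floor/excess hypotheses of `abs_im_expect_commutator_le_sqrt` and the double-commutator bounds `D₁`, `D₂`:
`‖⟨φ, (HX − XH) φ⟩‖ ≤ √(2 ε D₁) + √(2 ε D₂)`. [cite: PuszWoronowicz1978, §1] -/
theorem norm_expect_commutator_le_sqrt_add_sqrt {H B₁ B₂ X Q : Matrix n n ℂ} (hH : H.IsHermitian)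
    (hB₁ : B₁.IsHermitian) (hB₂ : B₂.IsHermitian) (hB₁Q : Commute B₁ Q) (hB₂Q : Commute B₂ Q)
    (hX : X = B₁ + (I : ℂ) • B₂) {q : ℂ} {φ : n → ℂ} (hφ1 : star φ ⬝ᵥ φ = 1)
    (hφQ : Q *ᵥ φ = q • φ) {E ε D₁ D₂ : ℝ} (hD₁ : 0 ≤ D₁) (hD₂ : 0 ≤ D₂)
    (hfloor : ∀ χ : n → ℂ, star χ ⬝ᵥ χ = 1 → Q *ᵥ χ = q • χ → E ≤ (star χ ⬝ᵥ (H *ᵥ χ)).re)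
    (hε : (star φ ⬝ᵥ (H *ᵥ φ)).re ≤ E + ε)
    (hDD₁ : ∀ χ : n → ℂ, star χ ⬝ᵥ χ = 1 →
      |(star χ ⬝ᵥ ((B₁ * (B₁ * H - H * B₁) - (B₁ * H - H * B₁) * B₁) *ᵥ χ)).re| ≤ D₁)
    (hDD₂ : ∀ χ : n → ℂ, star χ ⬝ᵥ χ = 1 →
      |(star χ ⬝ᵥ ((B₂ * (B₂ * H - H * B₂) - (B₂ * H - H * B₂) * B₂) *ᵥ χ)).re| ≤ D₂) :
    ‖star φ ⬝ᵥ ((H * X - X * H) *ᵥ φ)‖ ≤ Real.sqrt (2 * ε * D₁) + Real.sqrt (2 * ε * D₂) := by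
  have h1 := norm_expect_commutator_le_sqrt hH hB₁ hB₁Q hφ1 hφQ hD₁ hfloor hε hDD₁
  have h2 := norm_expect_commutator_le_sqrt hH hB₂ hB₂Q hφ1 hφQ hD₂ hfloor hε hDD₂
  have e : H * X - X * H = (H * B₁ - B₁ * H) + (I : ℂ) • (H * B₂ - B₂ * H) := by
    rw [hX, Matrix.mul_add, Matrix.add_mul, Matrix.mul_smul, Matrix.smul_mul, smul_sub]
    abel
  rw [e, add_mulVec, smul_mulVec, dotProduct_add, dotProduct_smul, smul_eq_mul]
  refine (norm_add_le _ _).trans (add_le_add h1 ?_)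
  rw [norm_mul, Complex.norm_I, one_mul]
  exact h2

end Matrix

end Literature.MathematicalPhysics.QuantumLattice

end
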